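import Literature.Computability.Complexity.CircuitDAG
import Literature.Computability.Complexity.ConstantDepth
import Summits.PneNP.PneNP.Theorems.SymmetryBudgetWindowCanoniserLabelsDefs

/-!
# Window canoniser, II: the gate type (definitions)

Route `PneNP/SymmetryBudget`, dichotomy `WindowBarrier` (stmt-PneNP-2145) / `NoHiddenOrder` (stmt-PneNP-14781);
continuation of `…WindowCanoniserLabelsDefs.lean`.  The canonising circuit is a `GateDAG` (tree file
`Literature/…/CircuitDAG.lean`) on the gate type `WCan.Node K r n` defined here, for an `(r + n) × (r + n)` input
matrix whose last `n` indices are the WINDOW (moved by the symmetry budget) and whose first `r` indices are fixed.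

Design.  Gates come in two sorts.
* ATOMS `WCan.Atom K r n` — the named gate families: a SHARED atom (constants, symmetrised input literals, the root
  colour refinement) or a LABELLED atom `(L, kind, parameters)` with `L : WCan.Lab K n` an admissible label,
  `kind : WCan.Kind` one of the families of the replay (state relations `W, LT, C, ARR, DEAD` of every iteration,
  switched graph, reachability, the branching cell, the selected vertex, the refinement rounds) and of the main
  computation (certification of candidate/part children, lifted colour ranks, lexicographic choice, pasting of parts,
  the value bits), and a UNIFORM parameter record `WCan.Prm r n` (iteration, round, five vertex slots, two height
  slots, two outside-vertex slots, a vertex-subset slot, a flag, two bit-index slots).  A family reads only the slots it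
  needs; records differing in unread slots index duplicate gates, which is harmless and keeps the symmetry action and
  the size bound uniform.
* FORMULA gates over atoms: negated atoms, width-8 conjunctions/disjunctions of literals (`WCan.N1`), and width-4
  conjunctions/disjunctions of those (`WCan.N2`).  All small Boolean combinations of the construction are such formula
  gates, so that only the atoms need individual treatment.
Here: the index arithmetic (`T`, `NB`, `NBp`), `Prm`, `SKind`, `Kind`, `Atom`, `Node`, the wires, the gate function of
every gate (`WCan.Node.fn`, all in `tcBasis`) and the relabelling action of `Sym(Fin n)` on gates (`WCan.Node.act`).
Wiring, levels and the DAG are in `…WindowCanoniserWiringDefs.lean`.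
-/

-- `Summit.PneNP.PneNP.…` duplicates `PneNP` BY DESIGN (single-problem summit, D-0017 layout).
set_option linter.dupNamespace false

namespace Summit.PneNP.PneNP.Theorems

namespace WCan

open Finset Equiv Literature.Computability.Complexity

/-! ### Index arithmetic -/

/-- Number of replay iterations: a root–node path of the process has at most `2n - 1` steps. -/
def T (n : ℕ) : ℕ := 2 * n + 2

/-- Number of VALUE BITS of a group: adjacency `(p,q)`, window-to-outside bits `(p,o)`, colour ranks `(p,j)`. -/
def NB (r n : ℕ) : ℕ := n * n + n * r + n * n

/-- Number of bits of a PART VECTOR: the size in one-hot (`n+1` bits) followed by the value bits. -/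
def NBp (r n : ℕ) : ℕ := (n + 1) + NB r n

/-- The meaning of a value-bit index. -/
inductive BIdx (r n : ℕ)
  /-- adjacency of positions `p` and `q` -/
  | adj (p q : Fin n)
  /-- adjacency of position `p` to the outside vertex `o` -/
  | ext (p : Fin n) (o : Fin r)
  /-- the colour of position `p` has rank `j` -/
  | crk (p j : Fin n)

/-- Decoding a value-bit index. -/
def bdec {r n : ℕ} (i : Fin (NB r n)) : BIdx r n :=
  match finSumFinEquiv.symm i with
  | Sum.inl i' =>
    match finSumFinEquiv.symm i' with
    | Sum.inl a => BIdx.adj (finProdFinEquiv.symm a).1 (finProdFinEquiv.symm a).2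
    | Sum.inr e => BIdx.ext (finProdFinEquiv.symm e).1 (finProdFinEquiv.symm e).2
  | Sum.inr c => BIdx.crk (finProdFinEquiv.symm c).1 (finProdFinEquiv.symm c).2

/-- The meaning of a part-vector index: a size bit or a value bit. -/
def bpdec {r n : ℕ} (i : Fin (NBp r n)) : Fin (n + 1) ⊕ Fin (NB r n) := finSumFinEquiv.symm i

/-! ### Parameters, kinds, atoms -/

/-- The uniform parameter record of an atom (every family reads only some slots). -/
structure Prm (r n : ℕ) where
  /-- replay iteration (a state index `≤ T n`) -/
  it : Fin (T n + 1)
  /-- refinement round / reach step -/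
  rd : Fin (n + 1)
  /-- a count threshold -/
  s : Fin (n + 1)
  /-- vertex slots (renamed by the symmetry action) -/
  vs : Fin 5 → Fin n
  /-- numeric slots: positions, ranks, block indices, offsets (fixed by the symmetry action) -/
  ns : Fin 3 → Fin n
  /-- height slot of the first candidate -/
  h1 : Fin (n + 1)
  /-- height slot of the second candidate -/
  h2 : Fin (n + 1)
  /-- first outside-vertex slot -/
  o1 : Option (Fin r)
  /-- second outside-vertex slot -/
  o2 : Option (Fin r)
  /-- vertex-subset slot (the `U'` of a part child) -/
  us : Finset (Fin n)
  /-- flag: the child is a part (else a candidate) -/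
  fl : Bool
  /-- bit-index / prefix-length slot for value vectors -/
  b : Fin (NB r n + 1)
  /-- bit-index / prefix-length slot for part vectors -/
  bp : Fin (NBp r n + 1)
  deriving DecidableEq

namespace Prm

variable {r n : ℕ}

/-- The product type behind the parameter record (for finiteness and counting). -/
abbrev Tuple (r n : ℕ) : Type :=
  (Fin (T n + 1) × Fin (n + 1) × Fin (n + 1) × (Fin 5 → Fin n) × (Fin 3 → Fin n)) ×
    (Fin (n + 1) × Fin (n + 1) × Option (Fin r) × Option (Fin r)) ×
    (Finset (Fin n) × Bool × Fin (NB r n + 1) × Fin (NBp r n + 1))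

/-- The parameter record is a product type. -/
def equivTuple : Prm r n ≃ Tuple r n where
  toFun P := ((P.it, P.rd, P.s, P.vs, P.ns), (P.h1, P.h2, P.o1, P.o2), (P.us, P.fl, P.b, P.bp))
  invFun t := ⟨t.1.1, t.1.2.1, t.1.2.2.1, t.1.2.2.2.1, t.1.2.2.2.2, t.2.1.1, t.2.1.2.1, t.2.1.2.2.1, t.2.1.2.2.2,
    t.2.2.1, t.2.2.2.1, t.2.2.2.2.1, t.2.2.2.2.2⟩
  left_inv P := by cases P; rfl
  right_inv t := by rcases t with ⟨⟨_, _, _, _, _⟩, ⟨_, _, _, _⟩, ⟨_, _, _, _⟩⟩; rfl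

/-- Instance. -/
instance : Fintype (Prm r n) := Fintype.ofEquiv _ equivTuple.symm

/-- Relabelling the window: vertex slots and the subset slot move, everything else is fixed. -/
def act (π : Perm (Fin n)) (P : Prm r n) : Prm r n :=
  { P with vs := fun i => π (P.vs i), us := P.us.map π.toEmbedding }

/-- `act_it`: bookkeeping/simp lemma (act it). -/
@[simp] theorem act_it (π : Perm (Fin n)) (P : Prm r n) : (P.act π).it = P.it := rfl
/-- `act_rd`: bookkeeping/simp lemma (act rd). -/
@[simp] theorem act_rd (π : Perm (Fin n)) (P : Prm r n) : (P.act π).rd = P.rd := rfl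
/-- `act_s`: bookkeeping/simp lemma (act s). -/
@[simp] theorem act_s (π : Perm (Fin n)) (P : Prm r n) : (P.act π).s = P.s := rfl
/-- `act_vs`: bookkeeping/simp lemma (act vs). -/
@[simp] theorem act_vs (π : Perm (Fin n)) (P : Prm r n) (i : Fin 5) : (P.act π).vs i = π (P.vs i) := rfl
/-- `act_ns`: bookkeeping/simp lemma (act ns). -/
@[simp] theorem act_ns (π : Perm (Fin n)) (P : Prm r n) : (P.act π).ns = P.ns := rfl
/-- `act_h1`: bookkeeping/simp lemma (act h1). -/
@[simp] theorem act_h1 (π : Perm (Fin n)) (P : Prm r n) : (P.act π).h1 = P.h1 := rfl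
/-- `act_h2`: bookkeeping/simp lemma (act h2). -/
@[simp] theorem act_h2 (π : Perm (Fin n)) (P : Prm r n) : (P.act π).h2 = P.h2 := rfl
/-- `act_o1`: bookkeeping/simp lemma (act o1). -/
@[simp] theorem act_o1 (π : Perm (Fin n)) (P : Prm r n) : (P.act π).o1 = P.o1 := rfl
/-- `act_o2`: bookkeeping/simp lemma (act o2). -/
@[simp] theorem act_o2 (π : Perm (Fin n)) (P : Prm r n) : (P.act π).o2 = P.o2 := rfl
/-- `act_us`: bookkeeping/simp lemma (act us). -/
@[simp] theorem act_us (π : Perm (Fin n)) (P : Prm r n) : (P.act π).us = P.us.map π.toEmbedding := rfl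
/-- `act_fl`: bookkeeping/simp lemma (act fl). -/
@[simp] theorem act_fl (π : Perm (Fin n)) (P : Prm r n) : (P.act π).fl = P.fl := rfl
/-- `act_b`: bookkeeping/simp lemma (act b). -/
@[simp] theorem act_b (π : Perm (Fin n)) (P : Prm r n) : (P.act π).b = P.b := rfl
/-- `act_bp`: bookkeeping/simp lemma (act bp). -/
@[simp] theorem act_bp (π : Perm (Fin n)) (P : Prm r n) : (P.act π).bp = P.bp := rfl

/-- `act_one`: bookkeeping/simp lemma (act one). -/
@[simp] theorem act_one (P : Prm r n) : P.act 1 = P := by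
  cases P; simp [act, Finset.map_eq_image]

/-- `act_mul`: bookkeeping/simp lemma (act mul). -/
theorem act_mul (π τ : Perm (Fin n)) (P : Prm r n) : P.act (π * τ) = (P.act τ).act π := by
  cases P; simp [act, Finset.map_map]; rfl

/-- `act_inv_act`: bookkeeping/simp lemma (act inv act). -/
@[simp] theorem act_inv_act (π : Perm (Fin n)) (P : Prm r n) : (P.act π).act π⁻¹ = P := by
  rw [← act_mul, inv_mul_cancel, act_one]

/-- `act_act_inv`: bookkeeping/simp lemma (act act inv). -/
@[simp] theorem act_act_inv (π : Perm (Fin n)) (P : Prm r n) : (P.act π⁻¹).act π = P := by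
  rw [← act_mul, mul_inv_cancel, act_one]

end Prm

/-- The SHARED gate families with parameters: symmetrised input literals (window–window, window–outside)
and the root colour refinement (strict colour order, neighbour-count comparison, its prefix conjunction, the
lexicographic clause). -/
inductive SKind
  | exV | exO | rLT | rcge | rallb | rlex
  deriving DecidableEq, Fintype

/-- The LABELLED gate families.  Replay: states `sW sLT sC sARR sDEAD`, `frz now cnt1`, switched graph `sw`,
reachability `reach`, connectivity `conn`, cell sizes `szGE big`, branching cell `bmc`, selection `sel hasSel`,
section move `pok nWs`, refinement `fLT fcge fallb flex`.  Main: colour ranks `rkGE`, certification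
`mtch thru cert`, lifting `pcand lcrk`, choice `pfx lexLE best ivbit inonbot`, parts `isP pcov pnonbot pbit rkInGE
pcP ppc pcrk ppfx plexLT pstGE pbcGE pat off blkI samePart spc svadj svext svcrk`, value `vbit`. -/
inductive Kind
  | sW | sLT | sC | sARR | sDEAD | frz | now | cnt1 | sw | reach | conn | szGE | big | bmc | sel | hasSel
  | pok | nWs | fLT | fcge | fallb | flex
  | rkGE | mtch | thru | cert | pcand | lcrk | pfx | lexLE | best | ivbit | inonbot | isP | pcov | pnonbot | pbit
  | rkInGE | pcP | ppc | pcrk | ppfx | plexLT | pstGE | pbcGE | pat | off | blkI | samePart | spc | svadj | svext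
  | svcrk | vbit
  deriving DecidableEq, Fintype

/-- The ATOMS: parameter-free constants, the outside–outside input literals and the OUTPUT gates (all fixed
by the symmetry action), the shared families and the labelled families (each with a parameter record). -/
inductive Atom (K r n : ℕ)
  /-- constant true -/
  | tt
  /-- constant false -/
  | ff
  /-- the symmetrised outside–outside entry `x(o,o') ∨ x(o',o)` -/
  | oo (o o' : Fin r)
  /-- output gate: value bit `b` of the root group (an `∨` over its `n` duplicate copies) -/
  | outv (b : Fin (NB r n))
  /-- a shared atom -/
  | sh (k : SKind) (P : Prm r n)
  /-- an atom of the group of the admissible label `L` -/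
  | lab (L : Lab K n) (k : Kind) (P : Prm r n)
  deriving DecidableEq, Fintype

namespace Atom

variable {K r n : ℕ}

/-- Relabelling acts on the label and on the parameters; constants, outside literals and outputs are fixed. -/
def act (π : Perm (Fin n)) : Atom K r n → Atom K r n
  | tt => tt
  | ff => ff
  | oo o o' => oo o o'
  | outv b => outv b
  | sh k P => sh k (P.act π)
  | lab L k P => lab (L.act π) k (P.act π)

/-- `act_tt`: bookkeeping/simp lemma (act tt). -/
@[simp] theorem act_tt (π : Perm (Fin n)) : (tt : Atom K r n).act π = tt := rfl
/-- `act_ff`: bookkeeping/simp lemma (act ff). -/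
@[simp] theorem act_ff (π : Perm (Fin n)) : (ff : Atom K r n).act π = ff := rfl
/-- `act_oo`: bookkeeping/simp lemma (act oo). -/
@[simp] theorem act_oo (π : Perm (Fin n)) (o o' : Fin r) : (oo o o' : Atom K r n).act π = oo o o' := rfl
/-- `act_outv`: bookkeeping/simp lemma (act outv). -/
@[simp] theorem act_outv (π : Perm (Fin n)) (b : Fin (NB r n)) : (outv b : Atom K r n).act π = outv b := rfl

/-- `act_sh`: bookkeeping/simp lemma (act sh). -/
@[simp] theorem act_sh (π : Perm (Fin n)) (k : SKind) (P : Prm r n) : (sh k P : Atom K r n).act π = sh k (P.act π) := rfl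
/-- `act_lab`: bookkeeping/simp lemma (act lab). -/
@[simp] theorem act_lab (π : Perm (Fin n)) (L : Lab K n) (k : Kind) (P : Prm r n) :
    (lab L k P : Atom K r n).act π = lab (L.act π) k (P.act π) := rfl

/-- `act_inv_act`: bookkeeping/simp lemma (act inv act). -/
@[simp] theorem act_inv_act (π : Perm (Fin n)) (a : Atom K r n) : (a.act π).act π⁻¹ = a := by
  cases a <;> simp [act]

/-- `act_act_inv`: bookkeeping/simp lemma (act act inv). -/
@[simp] theorem act_act_inv (π : Perm (Fin n)) (a : Atom K r n) : (a.act π⁻¹).act π = a := by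
  cases a <;> simp [act]

end Atom

end WCan

end Summit.PneNP.PneNP.Theorems
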